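import Mathlib.Analysis.Calculus.ParametricIntegral
import Mathlib.MeasureTheory.Measure.Haar.Basic
import Mathlib.MeasureTheory.Group.Integral
import Mathlib.Topology.Compactness.LocallyCompact
import Literature.NumberTheory.Automorphic.ArchimedeanEnvelopingActionRegular
import HarnessLib

/-!
# Moderate growth of Lie derivatives from Harish-Chandra's convolution identity, for a general
regular automorphy datum (Borel–Jacquet 4.3 (ii), the moderate-growth step; MW Lemma I.2.5 (a))

Topic `NumberTheory/Automorphic`; the general-datum version of `HarishChandraGrowthGL` and of the
weight calculus of `HarishChandraConvolutionGL`, closing the reduction of the named fact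
`automorphicForms_isStableSubmodule 𝒟` (`AutomorphicForms`; Borel–Jacquet 1979, 4.3) to
Harish-Chandra's convolution identity AS PRINTED. Let `𝒟` be a regular automorphy datum over a
finite-dimensional coefficient algebra (`𝔤` the full Lie algebra of the closed linear group
`G_∞ = 𝒟.arch`), `ν` a Haar measure on `G_∞`, `φ` an automorphic form and `α ∈ C_c^∞(G_∞)` with
`φ(g) = ∫ φ(g x) α(x) dν(x)` (Harish-Chandra 1966, Thm. 1; Borel 1972, Thm. 3.18; Borel 1997, 2.14).

* `continuous_comp_mul_of_isArchSmooth` — `x ↦ φ (g ι(x))` is continuous on a linear real group with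
  full Lie algebra when `φ` is smooth in the archimedean variable (the exponential charts are open,
  `RealMatrixGroup.continuous_of_continuousAt_comp_expMem`; von Neumann–Cartan);
* `exists_hasDerivAt_left_translate_of_regular` — **the left-invariant derivative of a test
  function** on such a group: for `α` smooth (right exponential slices) with compact support and
  `X ∈ 𝔤` there is a continuous compactly supported `α_X` with
  `d/ds α(exp(-sX) x)|_{s=t} = α_X(exp(-tX) x)`; here `exp(-sX) x = x exp(-s Ad(x⁻¹) X)` turns the
  left flow into a right flow, `α_X(y) = (-(Ad y⁻¹ X) α)(y)`, continuous because every `Y α`,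
  `Y ∈ 𝔤`, is (`isArchSmooth_lieDeriv_of_regular` and the first point) and `Ad y⁻¹ X` has continuous
  coordinates;
* `lieDeriv_eq_integral_of_convolution_regular` — `(X φ)(g) = ∫ φ(g x) α_X(x) dν(x)` (left
  invariance of `ν`, differentiation under the integral sign; Borel 1997, Cor. 5.3 (1));
* `hasModerateGrowth_lieDeriv_of_convolution_regular` — hence **`X φ` has moderate growth**, by
  `1 ⊔ ‖g x‖ ≤ C_S (1 ⊔ ‖g‖)` on the compact support `S` of `α_X` (`IsRegular.height_mul_ofArch_le`);
* `automorphicForms_isStableSubmodule_of_convolution` — **Borel–Jacquet 4.3 for a general regular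
  datum on Harish-Chandra's convolution identity** (stated, like the `GL_n` named fact
  `AutomorphicRepsGL.exists_convolution_eq_self`, for every Borel structure and Haar measure on
  `G_∞`): with `automorphicForms_isStableSubmodule_of_hasModerateGrowth_lieDeriv` everything else is
  proved.

Everything here is proved; no definitions, no named facts.

## References

* A. Borel, H. Jacquet, *Automorphic forms and automorphic representations*, Proc. Sympos. Pure
  Math. 33 (Corvallis 1977), Part 1 (1979), §1.2 and 4.3 [BorelJacquetCorvallis1979].
* A. Borel, *Automorphic forms on `SL₂(ℝ)`* (1997), 2.1, Prop. 5.2, Cor. 5.3, 5.6 (c) [Borel1997].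
* C. Moeglin, J.-L. Waldspurger, *Spectral decomposition and Eisenstein series* (1995), Lemma
  I.2.5 (a), I.2.17 [MoeglinWaldspurger1995].
-/

noncomputable section

open scoped MatrixGroups Matrix ContDiff Topology
open Filter _root_.MeasureTheory

namespace Literature.NumberTheory.Automorphic

/-! ### Continuity and the left-invariant derivative on a group with full Lie algebra -/

section Weight

variable {A : Type*} [NormedCommRing A] [NormedAlgebra ℝ A] [NormedAlgebra ℚ A] [CompleteSpace A]
  [StarRing A] {N : Type*} [Fintype N] [DecidableEq N] {H : RealMatrixGroup A N}
  {G : Type*} [Group G] (ι : H.carrier →* G)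

set_option backward.isDefEq.respectTransparency false in
open scoped Matrix.Norms.Operator in
/-- **Functions smooth in the archimedean variable are continuous along the group**, for a linear
real group with full Lie algebra: if every `X` with `exp (tX) ∈ H` (all `t`) lies in `𝔤`, `A` is
finite-dimensional and `φ : G → ℂ` is smooth in the archimedean variable, then `x ↦ φ (g ι(x))` is
continuous on `H` for every `g` (its exponential slices `X ↦ φ (g ι(x₀) ι(exp X))` are smooth, and
the charts `X ↦ x₀ exp X` are open at `0`, `RealMatrixGroup.continuous_of_continuousAt_comp_expMem`).
Hall 2015, Cor. 3.44; Borel–Jacquet 1979, §1.1. [cite: Hall2015, Cor. 3.44] -/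
theorem continuous_comp_mul_of_isArchSmooth [FiniteDimensional ℝ A]
    (hreg : ∀ X : Matrix N N A, (∀ t : ℝ, expGL (t • X) ∈ H.carrier) → X ∈ H.lie)
    {φ : G → ℂ} (hφ : IsArchSmooth ι φ) (g : G) : Continuous fun x : H.carrier => φ (g * ι x) := by
  -- Mathlib idiom (Mathlib/Algebra/Lie/OfAssociative.lean), needed to name `𝔤.toSubmodule`
  letI : LieRing (Matrix N N A) := LieRing.ofAssociativeRing
  refine H.continuous_of_continuousAt_comp_expMem hreg fun x₀ => ?_
  have h := (hφ (g * ι x₀)).continuous.continuousAt (x := (0 : H.lie.toSubmodule))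
  simp only [map_mul, ← mul_assoc]
  exact h

set_option backward.isDefEq.respectTransparency false in
open scoped Matrix.Norms.Operator in
/-- **The left-invariant derivative of a test function on a linear real group with full Lie
algebra.** Let `α : H → ℂ` be compactly supported and smooth (`IsArchSmooth` for the identity of
`H`: all right exponential slices `Y ↦ α (y exp Y)` are `C^∞`), `A` finite-dimensional, `𝔤` full, and
`X ∈ 𝔤`. Then there is a continuous compactly supported `α_X : H → ℂ` such that
`s ↦ α (exp(-sX) x)` has derivative `α_X (exp(-tX) x)` at every `t`, for every `x`. Since
`exp(-sX) y = y exp(-s Ad(y⁻¹) X)` (`expMem_mul_eq_mul_expMem_Ad_inv`), one may take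
`α_X(y) = (-(Ad(y⁻¹) X) α)(y)`; it is continuous because `α_X(y) = ∑ᵢ cᵢ(y) (Yᵢ α)(y)` for a basis
`Yᵢ` of `𝔤`, with `cᵢ(y)` the (continuous) coordinates of `-Ad(y⁻¹) X` and `Yᵢ α` continuous
(`isArchSmooth_lieDeriv_of_regular`, `continuous_comp_mul_of_isArchSmooth`), and it vanishes off the
support of `α`. Borel 1997, 2.1 (the operators `Y_r`); Knapp 2002, I.§10; Hall 2015, Cor. 3.44.
[cite: Borel1997, 2.1] -/
theorem exists_hasDerivAt_left_translate_of_regular [FiniteDimensional ℝ A]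
    (hreg : ∀ X : Matrix N N A, (∀ t : ℝ, expGL (t • X) ∈ H.carrier) → X ∈ H.lie)
    {α : H.carrier → ℂ} (hαs : HasCompactSupport α)
    (hα : IsArchSmooth (MonoidHom.id H.carrier) α) (X : H.lie) :
    ∃ αX : H.carrier → ℂ, Continuous αX ∧ HasCompactSupport αX ∧
      ∀ (x : H.carrier) (t : ℝ),
        HasDerivAt (fun s : ℝ => α ((H.expMem (s • X))⁻¹ * x)) (αX ((H.expMem (t • X))⁻¹ * x)) t := by
  classical
  -- Mathlib idiom (Mathlib/Algebra/Lie/OfAssociative.lean): the commutator Lie ring on matrices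
  letI : LieRing (Matrix N N A) := LieRing.ofAssociativeRing
  -- the weight `α_X(y) = (-(Ad y⁻¹ X) α)(y)`
  set αX : H.carrier → ℂ := fun y => lieDeriv (MonoidHom.id H.carrier) (-(H.Ad y⁻¹ X)) α y with hαX
  -- one-parameter group identities in `H`
  have hexp0 : H.expMem ((0 : ℝ) • X) = 1 := by
    refine Subtype.ext (Units.ext ?_)
    change NormedSpace.exp ((((0 : ℝ) • X : H.lie)) : Matrix N N A) = 1
    rw [show ((((0 : ℝ) • X : H.lie)) : Matrix N N A) = (0 : ℝ) • (X : Matrix N N A) from rfl,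
      zero_smul, NormedSpace.exp_zero]
  have hexp_add : ∀ s t : ℝ, H.expMem ((s + t) • X) = H.expMem (s • X) * H.expMem (t • X) :=
    fun s t => Subtype.ext (expGL_add_smul s t (X : Matrix N N A))
  have hexp_neg : ∀ s : ℝ, (H.expMem (s • X))⁻¹ = H.expMem (-(s • X)) := fun s => by
    refine Subtype.ext ?_
    change (expGL ((s • X : H.lie) : Matrix N N A))⁻¹ = expGL (((-(s • X) : H.lie)) : Matrix N N A)
    rw [show (((-(s • X) : H.lie)) : Matrix N N A) = -((s • X : H.lie) : Matrix N N A) from rfl,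
      expGL_neg]
  -- (i) the left flow is a right flow: `(exp sX)⁻¹ y = y exp (s · (-(Ad y⁻¹ X)))`
  have hflow : ∀ (y : H.carrier) (s : ℝ),
      (H.expMem (s • X))⁻¹ * y = y * H.expMem (s • (-(H.Ad y⁻¹ X))) := by
    intro y s
    rw [hexp_neg, expMem_mul_eq_mul_expMem_Ad_inv, map_neg, map_smul, smul_neg]
  -- (ii) derivative at `0`, at every base point
  have hd0 : ∀ y : H.carrier,
      HasDerivAt (fun s : ℝ => α ((H.expMem (s • X))⁻¹ * y)) (αX y) 0 := by
    intro y
    have h := hα.hasDerivAt_flow_zero (MonoidHom.id H.carrier) (-(H.Ad y⁻¹ X)) y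
    refine h.congr_of_eventuallyEq (Eventually.of_forall fun s => ?_)
    change α ((H.expMem (s • X))⁻¹ * y) = α (y * H.expMem (s • -(H.Ad y⁻¹ X)))
    rw [hflow]
  -- (iii) derivative at every `t`, by the flow property
  have hderiv : ∀ (x : H.carrier) (t : ℝ),
      HasDerivAt (fun s : ℝ => α ((H.expMem (s • X))⁻¹ * x)) (αX ((H.expMem (t • X))⁻¹ * x)) t := by
    intro x t
    set y : H.carrier := (H.expMem (t • X))⁻¹ * x with hy
    have hsplit : ∀ u : ℝ, (H.expMem ((t + u) • X))⁻¹ * x = (H.expMem (u • X))⁻¹ * y := by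
      intro u
      rw [hy, ← mul_assoc, ← mul_inv_rev, hexp_add]
    have h1 : HasDerivAt (fun u : ℝ => α ((H.expMem ((t + u) • X))⁻¹ * x)) (αX y) (-t + t) := by
      rw [neg_add_cancel]
      simp only [hsplit]
      exact hd0 y
    have h2 := h1.comp_const_add (-t) t
    simp only [add_neg_cancel_left] at h2
    exact h2
  refine ⟨αX, ?_, ?_, hderiv⟩
  · -- (iv) continuity: expand `-(Ad y⁻¹ X)` in a basis of `𝔤`
    let b := Module.finBasis ℝ H.lie.toSubmodule
    -- the direction as an element of `𝔤`, continuous in `y`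
    set v : H.carrier → H.lie.toSubmodule := fun y =>
      ⟨((-(H.Ad y⁻¹ X) : H.lie) : Matrix N N A), (-(H.Ad y⁻¹ X)).2⟩ with hv_def
    have hvc : Continuous v := by
      refine Continuous.subtype_mk ?_ _
      have hfun : (fun y : H.carrier => ((-(H.Ad y⁻¹ X) : H.lie) : Matrix N N A)) = fun y : H.carrier =>
          -((((y : GL N A)⁻¹ : GL N A) : Matrix N N A) * (X : Matrix N N A) * ((y : GL N A) : Matrix N N A)) := by
        funext y
        rw [NegMemClass.coe_neg, RealMatrixGroup.Ad_apply_coe, Subgroup.coe_inv, inv_inv]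
      rw [hfun]
      exact (((Units.continuous_coe_inv.comp continuous_subtype_val).mul continuous_const).mul
        (Units.continuous_val.comp continuous_subtype_val)).neg
    -- the slices of `α` and their derivatives at `0`
    have hslice : ∀ (y : H.carrier) (Y : H.lie), lieDeriv (MonoidHom.id H.carrier) Y α y =
        fderiv ℝ (fun Z : H.lie.toSubmodule => α (y * H.expMem ⟨Z, Z.2⟩)) 0 ⟨Y, Y.2⟩ :=
      fun y Y => lieDeriv_apply_eq_fderiv (MonoidHom.id H.carrier) hα Y y
    -- `α_X(y) = ∑ᵢ cᵢ(y) (Yᵢ α)(y)`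
    have hsum : αX = fun y => ∑ i, (b.repr (v y) i) •
        lieDeriv (MonoidHom.id H.carrier) ⟨(b i : Matrix N N A), (b i).2⟩ α y := by
      funext y
      rw [hαX]
      dsimp only
      rw [hslice]
      have hvY : (⟨((-(H.Ad y⁻¹ X) : H.lie) : Matrix N N A), (-(H.Ad y⁻¹ X)).2⟩ : H.lie.toSubmodule) =
          v y := rfl
      rw [hvY]
      conv_lhs => rw [← b.sum_repr (v y)]
      rw [map_sum]
      refine Finset.sum_congr rfl fun i _ => ?_
      rw [map_smul, hslice]
    rw [hsum]
    refine continuous_finsetSum _ fun i _ => ?_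
    have hci : Continuous fun y : H.carrier => b.repr (v y) i :=
      (b.coord i).continuous_of_finiteDimensional.comp hvc
    have hDi : Continuous fun y : H.carrier =>
        lieDeriv (MonoidHom.id H.carrier) ⟨(b i : Matrix N N A), (b i).2⟩ α y := by
      have h := continuous_comp_mul_of_isArchSmooth (MonoidHom.id H.carrier) hreg
        (isArchSmooth_lieDeriv_of_regular (MonoidHom.id H.carrier) hreg
          (⟨(b i : Matrix N N A), (b i).2⟩ : H.lie) hα) 1
      simpa only [MonoidHom.id_apply, one_mul] using h
    exact hci.smul hDi
  · -- (v) compact support: `α_X` vanishes off the support of `α`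
    refine HasCompactSupport.intro' hαs (isClosed_tsupport α) fun y hy => ?_
    have hcont : Continuous fun s : ℝ => (H.expMem (s • X))⁻¹ * y :=
      (continuous_expMem_smul X).inv.mul continuous_const
    have h0 : (H.expMem ((0 : ℝ) • X))⁻¹ * y = y := by rw [hexp0, inv_one, one_mul]
    have hev : ∀ᶠ s in 𝓝 (0 : ℝ), α ((H.expMem (s • X))⁻¹ * y) = 0 := by
      have hopen : IsOpen (tsupport α)ᶜ := (isClosed_tsupport α).isOpen_compl
      have hy0 : (fun s : ℝ => (H.expMem (s • X))⁻¹ * y) 0 ∈ (tsupport α)ᶜ := by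
        change (H.expMem ((0 : ℝ) • X))⁻¹ * y ∈ (tsupport α)ᶜ
        rwa [h0]
      filter_upwards [hcont.continuousAt.eventually_mem (hopen.mem_nhds hy0)] with s hs
      exact image_eq_zero_of_notMem_tsupport hs
    have hzero : HasDerivAt (fun s : ℝ => α ((H.expMem (s • X))⁻¹ * y)) 0 0 :=
      (hasDerivAt_const (0 : ℝ) (0 : ℂ)).congr_of_eventuallyEq hev
    have h := (hderiv y 0).unique hzero
    rwa [h0] at h

end Weight

/-! ### `X φ = φ ∗ α_X` and the moderate growth of `X φ`, for a regular datum -/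

section Datum

variable {K : Type} [Field K] [NumberField K]
  {A : Type*} [NormedCommRing A] [NormedAlgebra ℝ A] [NormedAlgebra ℚ A] [CompleteSpace A]
  [StarRing A] {N : Type*} [Fintype N] [DecidableEq N]
  {𝒢 : AdelicGroupData K} {𝒟 : AutomorphyDatum 𝒢 A N}

/-- **The Lie derivative of a convolution is the convolution with the derived weight** (general
regular datum). Let `φ` be smooth in the archimedean variable, `ν` a left-invariant Radon measure on
`G_∞`, `α ∈ C_c(G_∞)` with `φ(g) = ∫ φ(g x) α(x) dν(x)` for all `g`, and `α_X ∈ C_c(G_∞)` with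
`d/ds α(exp(-sX) x)|_{s=t} = α_X(exp(-tX) x)`. Then `(X φ)(g) = ∫ φ(g x) α_X(x) dν(x)`: by left
invariance `φ(g exp(tX)) = ∫ φ(g x) α(exp(-tX) x) dν(x)`, and one differentiates under the integral
sign (dominated convergence on `|t| < 1`). Borel 1997, Cor. 5.3 (1) (`D(f ∗ α) = f ∗ Dα`);
Moeglin–Waldspurger 1995, Lemma I.2.5 (a). [cite: Borel1997, Cor. 5.3] -/
theorem lieDeriv_eq_integral_of_convolution_regular [FiniteDimensional ℝ A]
    [MeasurableSpace 𝒟.arch.carrier] [BorelSpace 𝒟.arch.carrier] (h𝒟 : 𝒟.IsRegular)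
    (ν : Measure 𝒟.arch.carrier) [ν.IsHaarMeasure] {φ : 𝒢.Adelic → ℂ}
    (hφ : IsArchSmooth 𝒟.ofArch φ) {α αX : 𝒟.arch.carrier → ℂ}
    (hαc : Continuous α) (hαs : HasCompactSupport α) (hαXc : Continuous αX)
    (hαXs : HasCompactSupport αX) (X : 𝒟.arch.lie)
    (hconv : ∀ g : 𝒢.Adelic, φ g = ∫ x, φ (g * 𝒟.ofArch x) * α x ∂ν)
    (hderiv : ∀ (x : 𝒟.arch.carrier) (t : ℝ),
      HasDerivAt (fun s : ℝ => α ((𝒟.arch.expMem (s • X))⁻¹ * x))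
        (αX ((𝒟.arch.expMem (t • X))⁻¹ * x)) t)
    (g : 𝒢.Adelic) :
    lieDeriv 𝒟.ofArch X φ g = ∫ x, φ (g * 𝒟.ofArch x) * αX x ∂ν := by
  have hφg : Continuous fun x : 𝒟.arch.carrier => φ (g * 𝒟.ofArch x) :=
    continuous_comp_mul_of_isArchSmooth 𝒟.ofArch h𝒟.mem_lie_of_expGL_mem hφ g
  have hexpc : Continuous fun s : ℝ => 𝒟.arch.expMem (s • X) := continuous_expMem_smul X
  -- the parametrised integrand and its derivative
  set F : ℝ → 𝒟.arch.carrier → ℂ := fun t x =>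
    φ (g * 𝒟.ofArch x) * α ((𝒟.arch.expMem (t • X))⁻¹ * x) with hF_def
  set F' : ℝ → 𝒟.arch.carrier → ℂ := fun t x =>
    φ (g * 𝒟.ofArch x) * αX ((𝒟.arch.expMem (t • X))⁻¹ * x) with hF'_def
  -- `φ(g exp(tX)) = ∫ F t`, by the convolution identity and left invariance of `ν`
  have hFt : ∀ t : ℝ, φ (g * 𝒟.ofArch (𝒟.arch.expMem (t • X))) = ∫ x, F t x ∂ν := by
    intro t
    rw [hconv (g * 𝒟.ofArch (𝒟.arch.expMem (t • X))), hF_def]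
    dsimp only
    conv_rhs => rw [← integral_mul_left_eq_self _ (𝒟.arch.expMem (t • X))]
    congr 1 with x
    rw [map_mul, inv_mul_cancel_left, mul_assoc]
  -- continuity of `F t`, `F' t` in `x`
  have hFc : ∀ t, Continuous (F t) := fun t =>
    hφg.mul (hαc.comp (continuous_const.mul continuous_id))
  have hF'c : ∀ t, Continuous (F' t) := fun t =>
    hφg.mul (hαXc.comp (continuous_const.mul continuous_id))
  -- a compact set carrying the supports of all `F' t`, `|t| ≤ 1`
  set S : Set 𝒟.arch.carrier :=
    (fun p : ℝ × 𝒟.arch.carrier => 𝒟.arch.expMem (p.1 • X) * p.2) '' (Set.Icc (-1) 1 ×ˢ tsupport αX)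
    with hS_def
  have hS : IsCompact S :=
    (isCompact_Icc.prod hαXs).image ((hexpc.comp continuous_fst).mul continuous_snd)
  obtain ⟨M, hM⟩ := hαXs.exists_bound_of_continuous hαXc
  set bound : 𝒟.arch.carrier → ℝ := S.indicator fun x => ‖φ (g * 𝒟.ofArch x)‖ * M
    with hbound_def
  have hsupp : ∀ t ∈ Metric.ball (0 : ℝ) 1, ∀ x, ‖F' t x‖ ≤ bound x := by
    intro t ht x
    rw [hF'_def, hbound_def]
    dsimp only
    by_cases hx : x ∈ S
    · rw [Set.indicator_of_mem hx, norm_mul]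
      exact mul_le_mul_of_nonneg_left (hM _) (norm_nonneg _)
    · -- off `S` the derived weight vanishes
      have hzero : αX ((𝒟.arch.expMem (t • X))⁻¹ * x) = 0 := by
        by_contra hne
        apply hx
        refine ⟨(t, (𝒟.arch.expMem (t • X))⁻¹ * x), ⟨?_, subset_tsupport _ hne⟩, ?_⟩
        · rw [Metric.mem_ball, dist_zero_right, Real.norm_eq_abs, abs_lt] at ht
          exact ⟨ht.1.le, ht.2.le⟩
        · dsimp only
          rw [mul_inv_cancel_left]
      rw [hzero, mul_zero, norm_zero, Set.indicator_of_notMem hx]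
  have hbound_int : Integrable bound ν := by
    rw [hbound_def]
    exact ((hφg.norm.mul continuous_const).continuousOn.integrableOn_compact hS).integrable_indicator
      hS.measurableSet
  have hF0_int : Integrable (F 0) ν := by
    refine (hFc 0).integrable_of_hasCompactSupport ?_
    refine HasCompactSupport.mul_left ?_
    have h1 : (𝒟.arch.expMem ((0 : ℝ) • X))⁻¹ = 1 := by
      rw [inv_eq_one]
      refine Subtype.ext (Units.ext ?_)
      change NormedSpace.exp ((((0 : ℝ) • X : 𝒟.arch.lie)) : Matrix N N A) = 1
      rw [show ((((0 : ℝ) • X : 𝒟.arch.lie)) : Matrix N N A) = (0 : ℝ) • (X : Matrix N N A) from rfl,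
        zero_smul, NormedSpace.exp_zero]
    simpa only [h1, one_mul] using hαs
  have hdiff : ∀ x, ∀ t ∈ Metric.ball (0 : ℝ) 1, HasDerivAt (F · x) (F' t x) t := by
    intro x t _
    exact (hderiv x t).const_mul (φ (g * 𝒟.ofArch x))
  -- differentiate under the integral sign at `t = 0`
  have hmain := hasDerivAt_integral_of_dominated_loc_of_deriv_le (μ := ν) (F := F) (F' := F')
    (x₀ := (0 : ℝ)) (bound := bound) (Metric.ball_mem_nhds (0 : ℝ) one_pos)
    (Eventually.of_forall fun t => (hFc t).aestronglyMeasurable) hF0_int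
    ((hF'c 0).aestronglyMeasurable) (Eventually.of_forall fun x t ht => hsupp t ht x) hbound_int
    (Eventually.of_forall hdiff)
  -- identify the derivative at `0` with the Lie derivative
  have hdef : lieDeriv 𝒟.ofArch X φ g =
      deriv (fun t : ℝ => φ (g * 𝒟.ofArch (𝒟.arch.expMem (t • X)))) 0 := rfl
  have hcurve : (fun t : ℝ => φ (g * 𝒟.ofArch (𝒟.arch.expMem (t • X)))) = fun t => ∫ x, F t x ∂ν := by
    funext t
    exact hFt t
  rw [hdef, hcurve, hmain.2.deriv, hF'_def]
  have h1 : (𝒟.arch.expMem ((0 : ℝ) • X))⁻¹ = 1 := by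
    rw [inv_eq_one]
    refine Subtype.ext (Units.ext ?_)
    change NormedSpace.exp ((((0 : ℝ) • X : 𝒟.arch.lie)) : Matrix N N A) = 1
    rw [show ((((0 : ℝ) • X : 𝒟.arch.lie)) : Matrix N N A) = (0 : ℝ) • (X : Matrix N N A) from rfl,
      zero_smul, NormedSpace.exp_zero]
  simp only [h1, one_mul]

/-- **Moderate growth of Lie derivatives from the convolution identity, for a regular datum**
(Borel–Jacquet 1979, 4.3 (ii); Borel 1997, Prop. 5.2, Cor. 5.3, 5.6 (c); Moeglin–Waldspurger 1995,
Lemma I.2.5 (a)): let `𝒟` be regular over a finite-dimensional coefficient algebra and `ν` a Haar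
measure on `G_∞`; if every automorphic form `ψ` is `ψ ∗ α` for some `α ∈ C_c^∞(G_∞)`
(Harish-Chandra's convolution identity), then for every automorphic form `φ` and `X ∈ 𝔤` the Lie
derivative `X φ` has moderate growth: `X φ = φ ∗ α_X` (`exists_hasDerivAt_left_translate_of_regular`,
`lieDeriv_eq_integral_of_convolution_regular`) and
`‖X φ(g)‖ ≤ C (B (1 ⊔ ‖g‖))^r M ν(S)` with `S = supp α_X` compact, `1 ⊔ ‖g x‖ ≤ B (1 ⊔ ‖g‖)` on `S`
(`IsRegular.height_mul_ofArch_le`), `M` a bound for `α_X`. [cite: BorelJacquetCorvallis1979, 4.3] -/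
theorem hasModerateGrowth_lieDeriv_of_convolution_regular [FiniteDimensional ℝ A]
    [MeasurableSpace 𝒟.arch.carrier] [BorelSpace 𝒟.arch.carrier] (h𝒟 : 𝒟.IsRegular)
    (ν : Measure 𝒟.arch.carrier) [ν.IsHaarMeasure]
    (hHC : ∀ ψ : 𝒢.Adelic → ℂ, IsAutomorphicForm 𝒟 ψ →
      ∃ α : 𝒟.arch.carrier → ℂ, Continuous α ∧ HasCompactSupport α ∧
        IsArchSmooth (MonoidHom.id 𝒟.arch.carrier) α ∧
          ∀ g : 𝒢.Adelic, ψ g = ∫ x, ψ (g * 𝒟.ofArch x) * α x ∂ν)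
    {φ : 𝒢.Adelic → ℂ} (hφ : IsAutomorphicForm 𝒟 φ) (X : 𝒟.arch.lie) :
    HasModerateGrowth 𝒟 (lieDeriv 𝒟.ofArch X φ) := by
  obtain ⟨α, hαc, hαs, hαsm, hconv⟩ := hHC φ hφ
  obtain ⟨αX, hαXc, hαXs, hderiv⟩ :=
    exists_hasDerivAt_left_translate_of_regular h𝒟.mem_lie_of_expGL_mem hαs hαsm X
  have hint : ∀ g, lieDeriv 𝒟.ofArch X φ g = ∫ x, φ (g * 𝒟.ofArch x) * αX x ∂ν := fun g =>
    lieDeriv_eq_integral_of_convolution_regular h𝒟 ν hφ.archSmooth hαc hαs hαXc hαXs X hconv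
      hderiv g
  -- the constants
  obtain ⟨C, r, hCr⟩ := hφ.moderateGrowth
  set S := tsupport αX with hS_def
  have hS : IsCompact S := hαXs
  obtain ⟨B₀, hB₀⟩ := h𝒟.height_mul_ofArch_le S hS
  set B : ℝ := 1 ⊔ B₀ with hB_def
  have hB : ∀ x ∈ S, ∀ g, 1 ⊔ 𝒟.height (g * 𝒟.ofArch x) ≤ B * (1 ⊔ 𝒟.height g) :=
    fun x hx g => (hB₀ x hx g).trans
      (mul_le_mul_of_nonneg_right le_sup_right (le_trans zero_le_one le_sup_left))
  obtain ⟨M, hM⟩ := hαXs.exists_bound_of_continuous hαXc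
  have hM0 : 0 ≤ M := (norm_nonneg _).trans (hM 1)
  have hC0 : 0 ≤ C := by
    have h := hCr 1
    have hpos : (0 : ℝ) < (1 ⊔ 𝒟.height 1) ^ r := pow_pos (lt_of_lt_of_le one_pos le_sup_left) r
    exact nonneg_of_mul_nonneg_left ((norm_nonneg _).trans h) hpos
  refine ⟨C * B ^ r * M * ν.real S, r, fun g => ?_⟩
  have hg1 : (0 : ℝ) < 1 ⊔ 𝒟.height g := lt_of_lt_of_le one_pos le_sup_left
  set c : ℝ := C * (B * (1 ⊔ 𝒟.height g)) ^ r * M with hc_def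
  -- pointwise bound of the integrand
  have hptw : ∀ x, ‖φ (g * 𝒟.ofArch x) * αX x‖ ≤ S.indicator (fun _ => c) x := by
    intro x
    by_cases hx : x ∈ S
    · rw [Set.indicator_of_mem hx, norm_mul, hc_def]
      refine mul_le_mul ?_ (hM x) (norm_nonneg _) (by positivity)
      refine (hCr _).trans (mul_le_mul_of_nonneg_left ?_ hC0)
      exact pow_le_pow_left₀ (le_trans zero_le_one le_sup_left) (hB x hx g) r
    · have hzero : αX x = 0 := image_eq_zero_of_notMem_tsupport hx
      rw [hzero, mul_zero, norm_zero, Set.indicator_of_notMem hx]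
  -- integrate
  rw [hint g]
  refine (norm_integral_le_integral_norm _).trans ?_
  have hconst : Integrable (S.indicator fun _ : 𝒟.arch.carrier => c) ν :=
    (integrableOn_const (C := c) (hs := hS.measure_lt_top.ne)).integrable_indicator hS.measurableSet
  refine (integral_mono_of_nonneg (Eventually.of_forall fun x => norm_nonneg _) hconst
    (Eventually.of_forall hptw)).trans ?_
  rw [integral_indicator_const _ hS.measurableSet, smul_eq_mul, hc_def, mul_pow]
  have : ν.real S * (C * (B ^ r * (1 ⊔ 𝒟.height g) ^ r) * M) =
      C * B ^ r * M * ν.real S * (1 ⊔ 𝒟.height g) ^ r := by ring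
  rw [this]

set_option backward.isDefEq.respectTransparency false in
open scoped Matrix.Norms.Operator in
/-- **Borel–Jacquet 4.3 for a general regular datum on Harish-Chandra's convolution identity.**
Suppose that for every Borel structure and Haar measure `ν` on the archimedean group `G_∞ = 𝒟.arch`
of the regular datum `𝒟` (finite-dimensional coefficients) every automorphic form `φ` satisfies
`φ(g) = ∫ φ(g x) α(x) dν(x)` for some smooth compactly supported `α` on `G_∞` — Harish-Chandra's
theorem (Harish-Chandra 1966, Thm. 1; Borel 1972, Thm. 3.18 and Cor. 3.19; Borel 1997, Thm. 2.14;
the shape of the tree's `GL_n` named fact `AutomorphicRepsGL.exists_convolution_eq_self`). Then the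
space of automorphic forms of `𝒟` is a `(𝔤, K_∞) × G(𝔸_f)`-stable subspace
(`automorphicForms_isStableSubmodule 𝒟`): the Lie derivatives of automorphic forms have moderate
growth (`hasModerateGrowth_lieDeriv_of_convolution_regular`, for the Haar measure on the Borel
σ-algebra of the locally compact group `G_∞`), and everything else is
`automorphicForms_isStableSubmodule_of_hasModerateGrowth_lieDeriv`. Borel–Jacquet 1979, 4.3.
[cite: BorelJacquetCorvallis1979, 4.3] -/
theorem automorphicForms_isStableSubmodule_of_convolution
    (hHC : ∀ [FiniteDimensional ℝ A] [MeasurableSpace 𝒟.arch.carrier] [BorelSpace 𝒟.arch.carrier]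
      (ν : Measure 𝒟.arch.carrier) [ν.IsHaarMeasure], 𝒟.IsRegular →
        ∀ ψ : 𝒢.Adelic → ℂ, IsAutomorphicForm 𝒟 ψ →
          ∃ α : 𝒟.arch.carrier → ℂ, Continuous α ∧ HasCompactSupport α ∧
            IsArchSmooth (MonoidHom.id 𝒟.arch.carrier) α ∧
              ∀ g : 𝒢.Adelic, ψ g = ∫ x, ψ (g * 𝒟.ofArch x) * α x ∂ν) :
    automorphicForms_isStableSubmodule 𝒟 := by
  refine automorphicForms_isStableSubmodule_of_hasModerateGrowth_lieDeriv fun h𝒟 φ hφ X => ?_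
  -- the Borel structure and a Haar measure on the locally compact group `G_∞`
  letI : MeasurableSpace 𝒟.arch.carrier := borel _
  haveI : BorelSpace 𝒟.arch.carrier := ⟨rfl⟩
  haveI : ProperSpace A := FiniteDimensional.proper ℝ A
  haveI : LocallyCompactSpace (Matrix N N A) := inferInstanceAs (LocallyCompactSpace (N → N → A))
  haveI : LocallyCompactSpace (GL N A) := inferInstance
  haveI : LocallyCompactSpace 𝒟.arch.carrier := 𝒟.arch.isClosed.locallyCompactSpace
  exact hasModerateGrowth_lieDeriv_of_convolution_regular h𝒟 Measure.haar
    (fun ψ hψ => hHC Measure.haar h𝒟 ψ hψ) hφ X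

end Datum

end Literature.NumberTheory.Automorphic
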